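import Summits.CriticalPhenomena.CardyFormulaZ2.Theorems.CardyMagicRigidityNestingRigidityNeckRingArcT
import Summits.CriticalPhenomena.CardyFormulaZ2.Theorems.CardyMagicRigidityNestingRigidityNeckZ2RingIndexCells
import HarnessLib

/-!
# Crux `NestingRigidity`, line `pinch-resampling` (v4), stub S11: arc cells of fixed phase and rotated cell indices on the hexagonal ring

Crux `Summit.CriticalPhenomena.CardyFormulaZ2.Theses.CardyMagicRigidity.NestingRigidity` (stmt-CriticalPhenomena-4835),
line `pinch-resampling` v4, stub S11 `stub_neckHookupCoarseT : NeckHookupCoarseT`.  Worker W6c, wave 6: the site-`𝕋` twin of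
`…NeckZ2RingIndexCells` (worker W6a), on top of `…NeckRingArcT` (`triArcPos R d ∈ [0, 6R)`).  Cells of FIXED phase
`triCellIdx R ℓ d = ⌊triArcPos R d / ℓ⌋ ∈ [0, Nc)`, `Nc = ⌈6R / ℓ⌉`; the rotation acts on cell INDICES by the
lattice-independent `NeckCoarseZ2.rotIdx Nc a₀ C = C - a₀ (mod Nc)` of the `ℤ²` file, which is REUSED here together with
its cut lemma `NeckCoarseZ2.exists_good_cut` / `ringIndexCells_cut` (pure integer arithmetic, no lattice).

* §1 `triCellIdx`, ranges; `triNorm_sub_lt_of_rotIdx` (`|d - d'|_𝕋 < (Δ + 1) ℓ`, needs `6R ≤ Nc ℓ`) and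
  `le_two_mul_triNorm_sub_of_rotIdx` (`min (ℓ Δ, ℓ (Nc - Δ)) - 2ℓ + 1 ≤ 2 |d - d'|_𝕋`, needs `(Nc - 1) ℓ < 6R`), `Δ` the
  rotated index distance.
* §2 `triIdxPt R ℓ Nc a₀ t` — a ring point whose rotated index is `t` (`triNorm_triIdxPt`, `rotIdx_triCellIdx_triIdxPt`),
  registered anchor `triRingIndexCells_dictionary`.
-/

noncomputable section

namespace Summit.CriticalPhenomena.CardyFormulaZ2.Cruxes.NestingRigidity.PinchResampling

open Literature.Probability.Percolation Literature.Probability.LatticeModels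
open NeckCoarseZ2 (rotIdx rotIdx_nonneg rotIdx_lt)

namespace NeckCoarse

/-! ## §1 Cells of fixed phase and rotated indices -/

/-- **Cell index** of a ring offset at resolution `ℓ` (fixed phase): `⌊NeckCoarse.triArcPos / ℓ⌋`. -/
def triCellIdx (R ℓ : ℤ) (d : Site 2) : ℤ := NeckCoarse.triArcPos R d / ℓ

variable {R ℓ Nc a₀ : ℤ} {d d' : Site 2}

/-- The arc position lies in its cell: `ℓ C ≤ a < ℓ C + ℓ`. -/
theorem triCellIdx_mul_le (hℓ : 0 < ℓ) (d : Site 2) :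
    ℓ * triCellIdx R ℓ d ≤ NeckCoarse.triArcPos R d ∧ NeckCoarse.triArcPos R d < ℓ * triCellIdx R ℓ d + ℓ := by
  have h := Int.mul_ediv_add_emod (NeckCoarse.triArcPos R d) ℓ
  have h0 := Int.emod_nonneg (NeckCoarse.triArcPos R d) hℓ.ne'
  have h1 := Int.emod_lt_of_pos (NeckCoarse.triArcPos R d) hℓ
  unfold triCellIdx
  constructor <;> omega

/-- The cell index is nonnegative. -/
theorem triCellIdx_nonneg (hℓ : 0 < ℓ) (hd : triNorm d = R) : 0 ≤ triCellIdx R ℓ d :=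
  Int.ediv_nonneg (NeckCoarse.triArcPos_nonneg hd) hℓ.le

/-- The cell index is `< Nc` as soon as `6R ≤ Nc ℓ`. -/
theorem triCellIdx_lt (hℓ : 0 < ℓ) (hR : 1 ≤ R) (hd : triNorm d = R) (hNc : 6 * R ≤ Nc * ℓ) : triCellIdx R ℓ d < Nc := by
  have h := (triCellIdx_mul_le hℓ d (R := R)).1
  have h' := NeckCoarse.triArcPos_lt hR hd
  by_contra hcon
  have hcon' : Nc ≤ triCellIdx R ℓ d := le_of_not_gt hcon
  have : Nc * ℓ ≤ ℓ * triCellIdx R ℓ d := by nlinarith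
  omega

/-- **`𝕋`-distance `<` (rotated index distance `+ 1`) `· ℓ`** for two ring points (`6R ≤ Nc ℓ`, cut `a₀ ∈ [0, Nc)`). -/
theorem triNorm_sub_lt_of_rotIdx (hℓ : 0 < ℓ) (hR : 1 ≤ R) (hNc : 6 * R ≤ Nc * ℓ) (hd : triNorm d = R)
    (hd' : triNorm d' = R) :
    triNorm (d - d') < (|rotIdx Nc a₀ (triCellIdx R ℓ d) - rotIdx Nc a₀ (triCellIdx R ℓ d')| + 1) * ℓ := by
  have h1 := NeckCoarse.triNorm_sub_le_triArcDist hd hd'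
  have h2 := NeckCoarse.triNorm_sub_le_triArcDist' hd hd'
  obtain ⟨hX1, hX2⟩ := triCellIdx_mul_le hℓ d (R := R)
  obtain ⟨hY1, hY2⟩ := triCellIdx_mul_le hℓ d' (R := R)
  have hC0 := triCellIdx_nonneg hℓ hd
  have hC1 := triCellIdx_lt hℓ hR hd hNc
  have hD0 := triCellIdx_nonneg hℓ hd'
  have hD1 := triCellIdx_lt hℓ hR hd' hNc
  set C := triCellIdx R ℓ d
  set C' := triCellIdx R ℓ d'
  set a := NeckCoarse.triArcPos R d
  set a' := NeckCoarse.triArcPos R d'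
  -- multiply the rotated indices by `ℓ` to stay linear
  have key : (|rotIdx Nc a₀ C - rotIdx Nc a₀ C'| + 1) * ℓ = |ℓ * rotIdx Nc a₀ C - ℓ * rotIdx Nc a₀ C'| + ℓ := by
    rw [← mul_sub, abs_mul, abs_of_pos hℓ]; ring
  rw [key]
  have hXC : ℓ * (C - C') = ℓ * C - ℓ * C' := mul_sub _ _ _
  have hrot : ∀ E : ℤ, ℓ * rotIdx Nc a₀ E = if a₀ ≤ E then ℓ * E - ℓ * a₀ else ℓ * E - ℓ * a₀ + Nc * ℓ := by
    intro E
    unfold rotIdx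
    split_ifs <;> ring
  have hmonoC : (a₀ ≤ C → ℓ * a₀ ≤ ℓ * C) ∧ (C < a₀ → ℓ * C + ℓ ≤ ℓ * a₀) :=
    ⟨fun h ↦ mul_le_mul_of_nonneg_left h hℓ.le, fun h ↦ by nlinarith⟩
  have hmonoC' : (a₀ ≤ C' → ℓ * a₀ ≤ ℓ * C') ∧ (C' < a₀ → ℓ * C' + ℓ ≤ ℓ * a₀) :=
    ⟨fun h ↦ mul_le_mul_of_nonneg_left h hℓ.le, fun h ↦ by nlinarith⟩
  have hCC : (C ≤ C' → ℓ * C ≤ ℓ * C') ∧ (C' < C → ℓ * C' + ℓ ≤ ℓ * C) :=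
    ⟨fun h ↦ mul_le_mul_of_nonneg_left h hℓ.le, fun h ↦ by nlinarith⟩
  have hCN : ℓ * C + ℓ ≤ Nc * ℓ := by nlinarith
  have hCN' : ℓ * C' + ℓ ≤ Nc * ℓ := by nlinarith
  have hC0' : 0 ≤ ℓ * C := by positivity
  have hD0' : 0 ≤ ℓ * C' := by positivity
  rw [hrot C, hrot C']
  rw [abs_eq_max_neg] at h1 h2 ⊢
  rcases le_or_gt C C' with hle | hlt
  · have := hCC.1 hle
    split_ifs <;> omega
  · have := hCC.2 hlt
    split_ifs <;> omega

/-- **Conversely**: `min (ℓ Δ, ℓ (Nc - Δ)) - 2ℓ + 1 ≤ 2 |d - d'|_𝕋`, `Δ` the rotated index distance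
(`(Nc - 1) ℓ < 6R ≤ Nc ℓ`). -/
theorem le_two_mul_triNorm_sub_of_rotIdx (hℓ : 0 < ℓ) (hR : 1 ≤ R) (hNc : 6 * R ≤ Nc * ℓ)
    (hNc' : (Nc - 1) * ℓ < 6 * R) (hd : triNorm d = R) (hd' : triNorm d' = R) :
    min (ℓ * |rotIdx Nc a₀ (triCellIdx R ℓ d) - rotIdx Nc a₀ (triCellIdx R ℓ d')|)
      (ℓ * (Nc - |rotIdx Nc a₀ (triCellIdx R ℓ d) - rotIdx Nc a₀ (triCellIdx R ℓ d')|)) - 2 * ℓ + 1 ≤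
      2 * triNorm (d - d') := by
  have h := NeckCoarse.triArcDist_le_two_mul_triNorm_sub hd hd'
  obtain ⟨hX1, hX2⟩ := triCellIdx_mul_le hℓ d (R := R)
  obtain ⟨hY1, hY2⟩ := triCellIdx_mul_le hℓ d' (R := R)
  have hC0 := triCellIdx_nonneg hℓ hd
  have hC1 := triCellIdx_lt hℓ hR hd hNc
  have hD0 := triCellIdx_nonneg hℓ hd'
  have hD1 := triCellIdx_lt hℓ hR hd' hNc
  set C := triCellIdx R ℓ d
  set C' := triCellIdx R ℓ d'
  set a := NeckCoarse.triArcPos R d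
  set a' := NeckCoarse.triArcPos R d'
  have key1 : ℓ * |rotIdx Nc a₀ C - rotIdx Nc a₀ C'| = |ℓ * rotIdx Nc a₀ C - ℓ * rotIdx Nc a₀ C'| := by
    rw [← mul_sub, abs_mul, abs_of_pos hℓ]
  have key2 : ℓ * (Nc - |rotIdx Nc a₀ C - rotIdx Nc a₀ C'|) = Nc * ℓ - |ℓ * rotIdx Nc a₀ C - ℓ * rotIdx Nc a₀ C'| := by
    rw [mul_sub, key1]; ring
  rw [key1, key2]
  have hrot : ∀ E : ℤ, ℓ * rotIdx Nc a₀ E = if a₀ ≤ E then ℓ * E - ℓ * a₀ else ℓ * E - ℓ * a₀ + Nc * ℓ := by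
    intro E
    unfold rotIdx
    split_ifs <;> ring
  have hmonoC : (a₀ ≤ C → ℓ * a₀ ≤ ℓ * C) ∧ (C < a₀ → ℓ * C + ℓ ≤ ℓ * a₀) :=
    ⟨fun h ↦ mul_le_mul_of_nonneg_left h hℓ.le, fun h ↦ by nlinarith⟩
  have hmonoC' : (a₀ ≤ C' → ℓ * a₀ ≤ ℓ * C') ∧ (C' < a₀ → ℓ * C' + ℓ ≤ ℓ * a₀) :=
    ⟨fun h ↦ mul_le_mul_of_nonneg_left h hℓ.le, fun h ↦ by nlinarith⟩
  have hCC : (C ≤ C' → ℓ * C ≤ ℓ * C') ∧ (C' < C → ℓ * C' + ℓ ≤ ℓ * C) :=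
    ⟨fun h ↦ mul_le_mul_of_nonneg_left h hℓ.le, fun h ↦ by nlinarith⟩
  have hCN : ℓ * C + ℓ ≤ Nc * ℓ := by nlinarith
  have hCN' : ℓ * C' + ℓ ≤ Nc * ℓ := by nlinarith
  have hC0' : 0 ≤ ℓ * C := by positivity
  have hD0' : 0 ≤ ℓ * C' := by positivity
  have hNl : (Nc - 1) * ℓ = Nc * ℓ - ℓ := by ring
  rw [hNl] at hNc'
  rw [hrot C, hrot C']
  rw [abs_eq_max_neg] at h ⊢
  rcases le_or_gt C C' with hle | hlt
  · have := hCC.1 hle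
    split_ifs <;> omega
  · have := hCC.2 hlt
    split_ifs <;> omega

/-! ## §2 Ring points of rotated indices -/

/-- **A ring point of rotated index `t`**: the first point of the cell `t + a₀ (mod Nc)`. -/
def triIdxPt (R ℓ Nc a₀ t : ℤ) : Site 2 := NeckCoarse.triArcPt R (ℓ * (if t + a₀ < Nc then t + a₀ else t + a₀ - Nc))

variable {t : ℤ}

/-- `triIdxPt` lies on the ring (`(Nc - 1) ℓ < 6R`). -/
theorem triNorm_triIdxPt (hℓ : 0 < ℓ) (hNc' : (Nc - 1) * ℓ < 6 * R) (ha₀ : 0 ≤ a₀) (ha₀' : a₀ < Nc) (ht : 0 ≤ t)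
    (ht' : t < Nc) : triNorm (triIdxPt R ℓ Nc a₀ t) = R := by
  obtain ⟨h0, h1⟩ := NeckCoarseZ2.idxPt_cell_range ha₀ ha₀' ht ht' (t := t)
  set m := (if t + a₀ < Nc then t + a₀ else t + a₀ - Nc) with hm
  have hm1 : ℓ * m ≤ (Nc - 1) * ℓ := by nlinarith
  unfold triIdxPt
  rw [← hm]
  exact NeckCoarse.triNorm_triArcPt (by positivity) (by omega)

/-- The cell index of `triIdxPt` is `t + a₀ (mod Nc)`. -/
theorem triCellIdx_triIdxPt (hℓ : 0 < ℓ) (hNc' : (Nc - 1) * ℓ < 6 * R) (ha₀ : 0 ≤ a₀) (ha₀' : a₀ < Nc) (ht : 0 ≤ t)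
    (ht' : t < Nc) : triCellIdx R ℓ (triIdxPt R ℓ Nc a₀ t) = (if t + a₀ < Nc then t + a₀ else t + a₀ - Nc) := by
  obtain ⟨h0, h1⟩ := NeckCoarseZ2.idxPt_cell_range ha₀ ha₀' ht ht' (t := t)
  set m := (if t + a₀ < Nc then t + a₀ else t + a₀ - Nc) with hm
  have hm1 : ℓ * m ≤ (Nc - 1) * ℓ := by nlinarith
  unfold triIdxPt triCellIdx
  rw [← hm, NeckCoarse.triArcPos_triArcPt (by omega), Int.mul_ediv_cancel_left _ hℓ.ne']

/-- **The rotated index of `triIdxPt R ℓ Nc a₀ t` is `t`.** -/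
theorem rotIdx_triCellIdx_triIdxPt (hℓ : 0 < ℓ) (hNc' : (Nc - 1) * ℓ < 6 * R) (ha₀ : 0 ≤ a₀) (ha₀' : a₀ < Nc)
    (ht : 0 ≤ t) (ht' : t < Nc) : rotIdx Nc a₀ (triCellIdx R ℓ (triIdxPt R ℓ Nc a₀ t)) = t := by
  rw [triCellIdx_triIdxPt hℓ hNc' ha₀ ha₀' ht ht']
  unfold rotIdx
  split_ifs <;> omega


end NeckCoarse

/-- **Dictionary between rotated cell indices of the hexagonal ring and `𝕋`-norm geometry (registered helper, anchor of this
module on the crux item).**  For `0 < ℓ`, `1 ≤ R`, `6R ≤ Nc ℓ`, `(Nc - 1) ℓ < 6R`, a cut `a₀ ∈ [0, Nc)` and ring points `d, d'`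
(`|d|_𝕋 = |d'|_𝕋 = R`) with rotated indices `ρ, ρ'`: `|d - d'|_𝕋 < (|ρ - ρ'| + 1) ℓ`,
`min (ℓ |ρ - ρ'|, ℓ (Nc - |ρ - ρ'|)) - 2ℓ + 1 ≤ 2 |d - d'|_𝕋`, and for `0 ≤ t < Nc` the point `triIdxPt R ℓ Nc a₀ t` is a ring
point of rotated index `t`. -/
theorem triRingIndexCells_dictionary : ∀ (R ℓ Nc a₀ : ℤ) (d d' : Site 2), 0 < ℓ → 1 ≤ R → 6 * R ≤ Nc * ℓ → (Nc - 1) * ℓ < 6 * R → 0 ≤ a₀ → a₀ < Nc → triNorm d = R → triNorm d' = R → triNorm (d - d') < (|NeckCoarseZ2.rotIdx Nc a₀ (NeckCoarse.triCellIdx R ℓ d) - NeckCoarseZ2.rotIdx Nc a₀ (NeckCoarse.triCellIdx R ℓ d')| + 1) * ℓ ∧ min (ℓ * |NeckCoarseZ2.rotIdx Nc a₀ (NeckCoarse.triCellIdx R ℓ d) - NeckCoarseZ2.rotIdx Nc a₀ (NeckCoarse.triCellIdx R ℓ d')|) (ℓ * (Nc - |NeckCoarseZ2.rotIdx Nc a₀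 (NeckCoarse.triCellIdx R ℓ d) - NeckCoarseZ2.rotIdx Nc a₀ (NeckCoarse.triCellIdx R ℓ d')|)) - 2 * ℓ + 1 ≤ 2 * triNorm (d - d') ∧ ∀ t : ℤ, 0 ≤ t → t < Nc → triNorm (NeckCoarse.triIdxPt R ℓ Nc a₀ t) = R ∧ NeckCoarseZ2.rotIdx Nc a₀ (NeckCoarse.triCellIdx R ℓ (NeckCoarse.triIdxPt R ℓ Nc a₀ t)) = t :=
  fun _ _ _ _ _ _ hℓ hR hNc hNc' ha₀ ha₀' hd hd' ↦ ⟨NeckCoarse.triNorm_sub_lt_of_rotIdx hℓ hR hNc hd hd',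
    NeckCoarse.le_two_mul_triNorm_sub_of_rotIdx hℓ hR hNc hNc' hd hd', fun _ ht ht' ↦
      ⟨NeckCoarse.triNorm_triIdxPt hℓ hNc' ha₀ ha₀' ht ht', NeckCoarse.rotIdx_triCellIdx_triIdxPt hℓ hNc' ha₀ ha₀' ht ht'⟩⟩

end Summit.CriticalPhenomena.CardyFormulaZ2.Cruxes.NestingRigidity.PinchResampling

end
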